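import Summits.AtomisticToContinuum.HydrodynamicLimit.Theses.SimpleMaterialRetardation

/-!
# Assembly of the split of `CalibratedClosureInBand` (route SimpleMaterialRetardation)

Step (iii) of the glue crux `CalibratedClosureInBand` (stmt-AtomisticToContinuum-17918), proved:
the identification piece (VirialLocalEquilibrium → EquilibriumCalibration → the enslaved-virial
law with a response `ζ = hsCompressibility − 1` on a band) and the transfer piece (that law →
NoConcentrationInBand → the collision virial tested against `∇χ`, over `3`, equals the EXCESS of
the time-integrated hard-sphere Euler flux over its ideal part, in band, in LG-probability) imply
the crux: `StressIsotropy` at `κ/2`, the excess-flux law at `κ/2`, minima of the packing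
thresholds / `σ₀`'s / kernel radii, the pathwise identity
`ΔM − ∫∫F = (ΔM − ∫∫F₀ − W/3) + (W/3 − (∫∫F − ∫∫F₀))`, outer-measure subadditivity and a squeeze.
The two pieces are stated inline (they become route items `VirialResponseCalibration`,
`ExcessFluxTransferInBand` at the split).
-/

namespace Summit.AtomisticToContinuum.HydrodynamicLimit.Theses.SimpleMaterialRetardation

open scoped BigOperators Topology Manifold Classical MeasureTheory ProbabilityTheory Matrix InnerProductSpace ComplexConjugate ContinuousMap
open Filter Set Function TopologicalSpace MeasureTheory

/-! ## Generic lemmas -/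

/-- Union bound + squeeze for measures of `N`-dependent events. -/
theorem tendsto_measure_mono_union {α : ℕ → Type*} [∀ N, MeasurableSpace (α N)]
    (μ : ∀ N, Measure (α N)) (A B C : ∀ N, Set (α N))
    (hA : Tendsto (fun N => μ N (A N)) atTop (𝓝 0))
    (hB : Tendsto (fun N => μ N (B N)) atTop (𝓝 0))
    (h : ∀ N, C N ⊆ A N ∪ B N) :
    Tendsto (fun N => μ N (C N)) atTop (𝓝 0) := by
  have h0 : Tendsto (fun N => μ N (A N) + μ N (B N)) atTop (𝓝 0) := by
    simpa using hA.add hB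
  refine tendsto_of_tendsto_of_tendsto_of_le_of_le tendsto_const_nhds h0 (fun N => zero_le) ?_
  intro N
  exact (measure_mono (h N)).trans (measure_union_le _ _)

/-- Triangle inequality, contrapositive form. -/
theorem norm_split_half {E : Type*} [SeminormedAddCommGroup E] {a b d : E} {κ : ℝ}
    (h : d = a + b) (hκ : κ < ‖d‖) : κ / 2 < ‖a‖ ∨ κ / 2 < ‖b‖ := by
  by_contra hc
  push Not at hc
  have := norm_add_le a b
  rw [← h] at this
  linarith [hc.1, hc.2]

/-- Real (absolute value) version of `norm_split_half`. -/
theorem abs_split_half {a b d κ : ℝ}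
    (h : d = a + b) (hκ : κ < |d|) : κ / 2 < |a| ∨ κ / 2 < |b| := by
  by_contra hc
  push Not at hc
  have := abs_add_le a b
  rw [← h] at this
  linarith [hc.1, hc.2]

/-! ## The assembly -/

/-- ASSEMBLY of the split (step (iii) of the crux): isotropy + calibrated excess-flux law ⇒ the
hard-sphere Euler fluxes, by the union bound. -/
theorem calibratedClosureInBand_of_parts :
    (open Literature.MathematicalPhysics.KineticTheory Literature.Analysis.FluidPDE Literature.Analysis.FunctionSpaces in VirialLocalEquilibrium → EquilibriumCalibration → let ρK : {n : ℕ} → (T3 → ℝ) → Config (n) (Fin 3) T3 → T3 → ℝ := fun φ z x => empiricalDensityField z (fun y => φ (x - y)); let mK : {n : ℕ} → (T3 → ℝ) → Config (n) (Fin 3) T3 → T3 → V3 := fun φ z x => empiricalMomentumField z (fun y => φ (x - y)); let eK : {n : ℕ} → (T3 → ℝ) → Config (n) (Fin 3) T3 → T3 → ℝ := fun φ z x => empiricalEnergyField z (fun y => φ (x - y)); let θC : ℝ → V3 → ℝ → ℝ := fun ρ' m e => 2 / 3 * (e / ρ' - ‖m‖ ^ 2 / (2 * ρ' ^ 2)); let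 W : (N : ℕ) → ℝ → (T3 → V3) → ℝ → ℝ → (ℝ → Config (N + 1) (Fin 3) T3) → V3 := fun N σ' g s t γ => (((N : ℝ) + 1)⁻¹) • ∑ᶠ τ ∈ collisionTimes (Torus.geometry (Fin 3)) (hsDiameter σ' N) γ ∩ Set.Ioc s t, ∑ i : Fin (N + 1), ∑ j : Fin (N + 1), (if i < j then Set.indicator (contactSet (Torus.geometry (Fin 3)) (N + 1) (hsDiameter σ' N) i j) (fun z' => inner ℝ ((Torus.geometry (Fin 3)).sepVec (z' i).1 (z' j).1) ((z' i).2 - (Function.leftLim γ τ i).2) • g (z' i).1) (γ τ) else 0); let WV : (N : ℕ) → ℝ → (T3 → V3) → ℝ → ℝ → (ℝ → Config (N + 1) (Fin 3) T3) → ℝ := fun N σ' g s t γ => (((N : ℝ) + 1)⁻¹) * ∑ᶠ τ ∈ collisionTimes (Torus.geometry (Fin 3)) (hsDiameter σ' N) γ ∩ Set.Ioc s t, ∑ i : Fin (N + 1), ∑ j : Fin (N + 1), (if i < j then Set.indicator (contactSet (Torus.geometry (Fin 3)) (N + 1) (hsDiameter σ' N) i j) (fun z' => inner ℝ ((Torus.geometry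 (Fin 3)).sepVec (z' i).1 (z' j).1) ((z' i).2 - (Function.leftLim γ τ i).2) * inner ℝ (g (z' i).1) ((2 : ℝ)⁻¹ • ((z' i).2 + (z' j).2))) (γ τ) else 0); ∃ ζ : ℝ → ℝ, Continuous ζ ∧ (∃ ηs : ℝ, 0 < ηs ∧ ∀ η : ℝ, 0 < η → η ≤ ηs → ζ η = hsCompressibility η - 1) ∧ ∃ η₁ : ℝ, 0 < η₁ ∧ ∀ (a₀ θ₀ : T3 → ℝ) (u₀ : T3 → V3), Continuous a₀ → Continuous θ₀ → Continuous u₀ → (∀ x, 0 < a₀ x) → (∀ x, 0 < θ₀ x) → ∃ σ₀ : ℝ, 0 < σ₀ ∧ ∀ σ : ℝ, 0 < σ → σ < σ₀ → ∀ (T : ℝ) (ρ θ : ℝ → T3 → ℝ) (u : ℝ → T3 → V3), IsHardSphereEulerSolution σ T ρ u θ → (∀ τ ∈ Set.Ico 0 T, ∀ x, ρ τ x * σ ^ 3 ≤ η₁) → ∀ Φ : (N : ℕ) → HardSphereFlow (Torus.geometry (Fin 3)) (hsDiameter σ N) (N + 1), TendstoHydroFieldsAt (fun N => localGibbsLaw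 σ a₀ u₀ θ₀ N (Φ N)) Φ ρ u θ 0 → ∀ s t : ℝ, 0 ≤ s → s ≤ t → t < T → ∀ g : T3 → V3, Continuous g → ∀ κ : ℝ, 0 < κ → ∃ r : ℝ, 0 < r ∧ ∀ φ : T3 → ℝ, Continuous φ → (∀ y, 0 ≤ φ y) → ∫ y, φ y = 1 → (∀ y, r ≤ ‖y‖ → φ y = 0) → Filter.Tendsto (fun N : ℕ => localGibbsLaw σ a₀ u₀ θ₀ N (Φ N) {z | κ < ‖W N σ g s t (fun τ => (Φ N).flow τ z) - ∫ τ in Set.Ioc s t, ∫ x, (3 * (ρK φ ((Φ N).flow τ z) x * θC (ρK φ ((Φ N).flow τ z) x) (mK φ ((Φ N).flow τ z) x) (eK φ ((Φ N).flow τ z) x)) * ζ (ρK φ ((Φ N).flow τ z) x * σ ^ 3)) • g x‖ ∨ κ < |WV N σ g s t (fun τ => (Φ N).flow τ z) - ∫ τ in Set.Ioc s t, ∫ x, (3 * (ρK φ ((Φ N).flow τ z) x * θC (ρK φ ((Φ N).flow τ z) x) (mK φ ((Φ N).flow τ z) x) (eK φ ((Φ N).flow τ z) x)) * ζ (ρK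 φ ((Φ N).flow τ z) x * σ ^ 3)) / ρK φ ((Φ N).flow τ z) x * inner ℝ (mK φ ((Φ N).flow τ z) x) (g x)|}) Filter.atTop (nhds 0)) →
    (open Literature.MathematicalPhysics.KineticTheory Literature.Analysis.FluidPDE Literature.Analysis.FunctionSpaces in (let ρK : {n : ℕ} → (T3 → ℝ) → Config (n) (Fin 3) T3 → T3 → ℝ := fun φ z x => empiricalDensityField z (fun y => φ (x - y)); let mK : {n : ℕ} → (T3 → ℝ) → Config (n) (Fin 3) T3 → T3 → V3 := fun φ z x => empiricalMomentumField z (fun y => φ (x - y)); let eK : {n : ℕ} → (T3 → ℝ) → Config (n) (Fin 3) T3 → T3 → ℝ := fun φ z x => empiricalEnergyField z (fun y => φ (x - y)); let θC : ℝ → V3 → ℝ → ℝ := fun ρ' m e => 2 / 3 * (e / ρ' - ‖m‖ ^ 2 / (2 * ρ' ^ 2)); let W : (N : ℕ) → ℝ → (T3 → V3) → ℝ → ℝ → (ℝ → Config (N + 1) (Fin 3) T3) → V3 := fun N σ' g s t γ => (((N : ℝ) + 1)⁻¹) • ∑ᶠ τ ∈ collisionTimes (Torus.geometry (Fin 3))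 (hsDiameter σ' N) γ ∩ Set.Ioc s t, ∑ i : Fin (N + 1), ∑ j : Fin (N + 1), (if i < j then Set.indicator (contactSet (Torus.geometry (Fin 3)) (N + 1) (hsDiameter σ' N) i j) (fun z' => inner ℝ ((Torus.geometry (Fin 3)).sepVec (z' i).1 (z' j).1) ((z' i).2 - (Function.leftLim γ τ i).2) • g (z' i).1) (γ τ) else 0); let WV : (N : ℕ) → ℝ → (T3 → V3) → ℝ → ℝ → (ℝ → Config (N + 1) (Fin 3) T3) → ℝ := fun N σ' g s t γ => (((N : ℝ) + 1)⁻¹) * ∑ᶠ τ ∈ collisionTimes (Torus.geometry (Fin 3)) (hsDiameter σ' N) γ ∩ Set.Ioc s t, ∑ i : Fin (N + 1), ∑ j : Fin (N + 1), (if i < j then Set.indicator (contactSet (Torus.geometry (Fin 3)) (N + 1) (hsDiameter σ' N) i j) (fun z' => inner ℝ ((Torus.geometry (Fin 3)).sepVec (z' i).1 (z' j).1) ((z' i).2 - (Function.leftLim γ τ i).2) * inner ℝ (g (z' i).1) ((2 : ℝ)⁻¹ • ((z' i).2 + (z' j).2))) (γ τ) else 0); ∃ ζ : ℝ → ℝ,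 Continuous ζ ∧ (∃ ηs : ℝ, 0 < ηs ∧ ∀ η : ℝ, 0 < η → η ≤ ηs → ζ η = hsCompressibility η - 1) ∧ ∃ η₁ : ℝ, 0 < η₁ ∧ ∀ (a₀ θ₀ : T3 → ℝ) (u₀ : T3 → V3), Continuous a₀ → Continuous θ₀ → Continuous u₀ → (∀ x, 0 < a₀ x) → (∀ x, 0 < θ₀ x) → ∃ σ₀ : ℝ, 0 < σ₀ ∧ ∀ σ : ℝ, 0 < σ → σ < σ₀ → ∀ (T : ℝ) (ρ θ : ℝ → T3 → ℝ) (u : ℝ → T3 → V3), IsHardSphereEulerSolution σ T ρ u θ → (∀ τ ∈ Set.Ico 0 T, ∀ x, ρ τ x * σ ^ 3 ≤ η₁) → ∀ Φ : (N : ℕ) → HardSphereFlow (Torus.geometry (Fin 3)) (hsDiameter σ N) (N + 1), TendstoHydroFieldsAt (fun N => localGibbsLaw σ a₀ u₀ θ₀ N (Φ N)) Φ ρ u θ 0 → ∀ s t : ℝ, 0 ≤ s → s ≤ t → t < T → ∀ g : T3 → V3, Continuous g → ∀ κ : ℝ, 0 < κ → ∃ r : ℝ, 0 < r ∧ ∀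 φ : T3 → ℝ, Continuous φ → (∀ y, 0 ≤ φ y) → ∫ y, φ y = 1 → (∀ y, r ≤ ‖y‖ → φ y = 0) → Filter.Tendsto (fun N : ℕ => localGibbsLaw σ a₀ u₀ θ₀ N (Φ N) {z | κ < ‖W N σ g s t (fun τ => (Φ N).flow τ z) - ∫ τ in Set.Ioc s t, ∫ x, (3 * (ρK φ ((Φ N).flow τ z) x * θC (ρK φ ((Φ N).flow τ z) x) (mK φ ((Φ N).flow τ z) x) (eK φ ((Φ N).flow τ z) x)) * ζ (ρK φ ((Φ N).flow τ z) x * σ ^ 3)) • g x‖ ∨ κ < |WV N σ g s t (fun τ => (Φ N).flow τ z) - ∫ τ in Set.Ioc s t, ∫ x, (3 * (ρK φ ((Φ N).flow τ z) x * θC (ρK φ ((Φ N).flow τ z) x) (mK φ ((Φ N).flow τ z) x) (eK φ ((Φ N).flow τ z) x)) * ζ (ρK φ ((Φ N).flow τ z) x * σ ^ 3)) / ρK φ ((Φ N).flow τ z) x * inner ℝ (mK φ ((Φ N).flow τ z) x) (g x)|}) Filter.atTop (nhds 0)) → NoConcentrationInBand → let ρK : {n : ℕ} → (T3 → ℝ)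 → Config (n) (Fin 3) T3 → T3 → ℝ := fun φ z x => empiricalDensityField z (fun y => φ (x - y)); let mK : {n : ℕ} → (T3 → ℝ) → Config (n) (Fin 3) T3 → T3 → V3 := fun φ z x => empiricalMomentumField z (fun y => φ (x - y)); let eK : {n : ℕ} → (T3 → ℝ) → Config (n) (Fin 3) T3 → T3 → ℝ := fun φ z x => empiricalEnergyField z (fun y => φ (x - y)); let θC : ℝ → V3 → ℝ → ℝ := fun ρ' m e => 2 / 3 * (e / ρ' - ‖m‖ ^ 2 / (2 * ρ' ^ 2)); let momFlux : ℝ → ℝ → V3 → ℝ → V3 → V3 := fun σ' ρ' m e g => (inner ℝ m g / ρ') • m + hsPressure σ' ρ' (θC ρ' m e) • g; let enFlux : ℝ → ℝ → V3 → ℝ → V3 → ℝ := fun σ' ρ' m e g => (e + hsPressure σ' ρ' (θC ρ' m e)) / ρ' * inner ℝ m g; let momFlux0 : ℝ → V3 → ℝ → V3 → V3 := fun ρ' m e g => (inner ℝ m g / ρ') • m + (ρ' * θC ρ' m e) • g; let enFlux0 : ℝ → V3 → ℝ → V3 → ℝ := fun ρ' m e g => (e + ρ' * θC ρ' m e) /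 ρ' * inner ℝ m g; let W : (N : ℕ) → ℝ → (T3 → V3) → ℝ → ℝ → (ℝ → Config (N + 1) (Fin 3) T3) → V3 := fun N σ' g s t γ => (((N : ℝ) + 1)⁻¹) • ∑ᶠ τ ∈ collisionTimes (Torus.geometry (Fin 3)) (hsDiameter σ' N) γ ∩ Set.Ioc s t, ∑ i : Fin (N + 1), ∑ j : Fin (N + 1), (if i < j then Set.indicator (contactSet (Torus.geometry (Fin 3)) (N + 1) (hsDiameter σ' N) i j) (fun z' => inner ℝ ((Torus.geometry (Fin 3)).sepVec (z' i).1 (z' j).1) ((z' i).2 - (Function.leftLim γ τ i).2) • g (z' i).1) (γ τ) else 0); let WV : (N : ℕ) → ℝ → (T3 → V3) → ℝ → ℝ → (ℝ → Config (N + 1) (Fin 3) T3) → ℝ := fun N σ' g s t γ => (((N : ℝ) + 1)⁻¹) * ∑ᶠ τ ∈ collisionTimes (Torus.geometry (Fin 3)) (hsDiameter σ' N) γ ∩ Set.Ioc s t, ∑ i : Fin (N + 1), ∑ j : Fin (N + 1), (if i < j then Set.indicator (contactSet (Torus.geometry (Fin 3)) (N + 1) (hsDiameter σ' N) i j) (fun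 z' => inner ℝ ((Torus.geometry (Fin 3)).sepVec (z' i).1 (z' j).1) ((z' i).2 - (Function.leftLim γ τ i).2) * inner ℝ (g (z' i).1) ((2 : ℝ)⁻¹ • ((z' i).2 + (z' j).2))) (γ τ) else 0); ∃ η₁ : ℝ, 0 < η₁ ∧ ∀ (a₀ θ₀ : T3 → ℝ) (u₀ : T3 → V3), Continuous a₀ → Continuous θ₀ → Continuous u₀ → (∀ x, 0 < a₀ x) → (∀ x, 0 < θ₀ x) → ∃ σ₀ : ℝ, 0 < σ₀ ∧ ∀ σ : ℝ, 0 < σ → σ < σ₀ → ∀ (T : ℝ) (ρ θ : ℝ → T3 → ℝ) (u : ℝ → T3 → V3), IsHardSphereEulerSolution σ T ρ u θ → (∀ τ ∈ Set.Ico 0 T, ∀ x, ρ τ x * σ ^ 3 < η₁) → ∀ Φ : (N : ℕ) → HardSphereFlow (Torus.geometry (Fin 3)) (hsDiameter σ N) (N + 1), TendstoHydroFieldsAt (fun N => localGibbsLaw σ a₀ u₀ θ₀ N (Φ N)) Φ ρ u θ 0 → ∀ s t : ℝ, 0 ≤ s → s ≤ t → t < T → ∀ χ : T3 → ℝ, Torus.IsSmooth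 χ → ∀ κ : ℝ, 0 < κ → ∃ r : ℝ, 0 < r ∧ ∀ φ : T3 → ℝ, Continuous φ → (∀ y, 0 ≤ φ y) → ∫ y, φ y = 1 → (∀ y, r ≤ ‖y‖ → φ y = 0) → Filter.Tendsto (fun N : ℕ => localGibbsLaw σ a₀ u₀ θ₀ N (Φ N) {z | κ < ‖(3 : ℝ)⁻¹ • W N σ (Torus.gradient χ) s t (fun τ => (Φ N).flow τ z) - ((∫ τ in Set.Ioc s t, ∫ x, momFlux σ (ρK φ ((Φ N).flow τ z) x) (mK φ ((Φ N).flow τ z) x) (eK φ ((Φ N).flow τ z) x) (Torus.gradient χ x)) - (∫ τ in Set.Ioc s t, ∫ x, momFlux0 (ρK φ ((Φ N).flow τ z) x) (mK φ ((Φ N).flow τ z) x) (eK φ ((Φ N).flow τ z) x) (Torus.gradient χ x)))‖ ∨ κ < |(3 : ℝ)⁻¹ * WV N σ (Torus.gradient χ) s t (fun τ => (Φ N).flow τ z) - ((∫ τ in Set.Ioc s t, ∫ x, enFlux σ (ρK φ ((Φ N).flow τ z) x) (mK φ ((Φ N).flow τ z) x) (eK φ ((Φ N).flow τ z) x) (Torus.gradient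 χ x)) - (∫ τ in Set.Ioc s t, ∫ x, enFlux0 (ρK φ ((Φ N).flow τ z) x) (mK φ ((Φ N).flow τ z) x) (eK φ ((Φ N).flow τ z) x) (Torus.gradient χ x)))|}) Filter.atTop (nhds 0)) →
    CalibratedClosureInBand := by
  intro h1 h2 hSI hVLE hEC hNC
  have hCVL := h2 (h1 hVLE hEC) hNC
  clear h1 h2 hVLE hEC hNC
  obtain ⟨η₁s, hη₁s, HS⟩ := hSI
  obtain ⟨η₁c, hη₁c, HC⟩ := hCVL
  refine ⟨min η₁s η₁c, lt_min hη₁s hη₁c, ?_⟩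
  intro a₀ θ₀ u₀ ha hθ hu hap hθp
  obtain ⟨σ₀s, hσ₀s, HS1⟩ := HS a₀ θ₀ u₀ ha hθ hu hap hθp
  obtain ⟨σ₀c, hσ₀c, HC1⟩ := HC a₀ θ₀ u₀ ha hθ hu hap hθp
  clear HS HC
  refine ⟨min σ₀s σ₀c, lt_min hσ₀s hσ₀c, ?_⟩
  intro σ hσ hσlt T ρ θ u hsol hguard Φ h0 s t hs hst htT χ hχ κ hκ
  obtain ⟨rs, hrs, HS3⟩ := HS1 σ hσ (hσlt.trans_le (min_le_left _ _)) T ρ θ u hsol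
    (fun τ hτ x => ((hguard τ hτ x).trans_le (min_le_left _ _)).le) Φ h0 s t hs hst htT χ hχ
    (κ / 2) (half_pos hκ)
  obtain ⟨rc, hrc, HC3⟩ := HC1 σ hσ (hσlt.trans_le (min_le_right _ _)) T ρ θ u hsol
    (fun τ hτ x => (hguard τ hτ x).trans_le (min_le_right _ _)) Φ h0 s t hs hst htT χ hχ
    (κ / 2) (half_pos hκ)
  clear HS1 HC1
  refine ⟨min rs rc, lt_min hrs hrc, ?_⟩
  intro φ hφc hφnn hφ1 hφsupp
  have HS4 := HS3 φ hφc hφnn hφ1 (fun y hy => hφsupp y ((min_le_left _ _).trans hy))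
  have HC4 := HC3 φ hφc hφnn hφ1 (fun y hy => hφsupp y ((min_le_right _ _).trans hy))
  clear HS3 HC3
  constructor
  · refine tendsto_measure_mono_union _ _ _ _ HS4 HC4 ?_
    intro N z hz
    simp only [Set.mem_setOf_eq, Set.mem_union] at hz ⊢
    refine (norm_split_half ?_ hz).imp Or.inl Or.inl
    abel
  · refine tendsto_measure_mono_union _ _ _ _ HS4 HC4 ?_
    intro N z hz
    simp only [Set.mem_setOf_eq, Set.mem_union] at hz ⊢
    refine (abs_split_half ?_ hz).imp Or.inr Or.inr
    ring

end Summit.AtomisticToContinuum.HydrodynamicLimit.Theses.SimpleMaterialRetardation
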